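import Summits.QuantumFields.YangMills.Theorems.BalabanUVNodesN19RateEdgeRecordRunLetters
import Summits.QuantumFields.YangMills.Theorems.BalabanUVNodesN26AtRecord13CoPH

/-!
# BalabanUVNodes ∕ N19 — THE (v′-17) RUN LETTERS OF `hlink` AT THE STAGE-13 `CoPH` RECORD BUNDLE FROM TUNING ALONE: the record's own (0.20) guard
# (`HaltsOutside` of the RG machine core of record) replaces the printed upper bound; the upper running read from K1⁷'s interval-form β-window

Cell `pub-ymgap` (HUMAN RULING D-0062, Track A; director-ym №197 ∕ HUMAN RULING D-0149), node N19 = NE7, WIDTH SEAT `pub-ymgap-dag-n19-w3` (g0); companion of this seat's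
`BalabanUVNodesN19RateEdgeRecordRunLetters` (p584398: the run letters from tuning + the printed-type BOX bound `BetaUpperH β′ γ D.βfun`, `γ²β′ < 1`).  Filed
`--kind proof --supports stmt-QuantumFields-20544 --as helper` (K3⁷ `SpineGivenEndpointR13SepCoPH`).  COUNT-NEUTRAL.  THEOREMS ONLY (0 `def`, 0 `sorry`, standard axioms); imports the
companion + dag-n26-c's `BalabanUVNodesN26AtRecord13CoPH` (p-landed; `haltsOutside_datumOfRecord₁₃CoPH`); edits nothing; no Theses import.

WHY A SECOND MODULE.  In the companion the (0.20)-run identification `∀ K, RGEqH K D.βfun (g K)` for the runs of record was run FORWARD through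
`T4TwoRunUniqueness.rgEqH_of_tuned`, which asks the printed-type box bound `BetaUpperH β′ γ D.βfun` with `γ²β′ < 1` ([Balaban1987RG1] p. 264, proof deferred in print).  AT THE ₁₃ `CoPH`
DATUM OF RECORD that hypothesis is UNNECESSARY: `datumOfRecord₁₃CoPH F N θ hP` is forward-generated (`D.fwd`), curries its β (`D.curries`), and HALTS OUTSIDE — def-T's RG machine core
reports a failed step by a non-positive coupling (`RGMachineCore.haltsOutside`; dag-n26-c's face `haltsOutside_datumOfRecord₁₃CoPH`, `βfun_datumOfRecord₁₃CoPH` being `rfl`) — so every run that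
stays in some `]0, γ]` solves (0.20) by `FlowStepRuns.rgEqH_of_inInterval` with NO β-side letter.  Hence six of the seven (v′-17) run clauses of `hlink` (run identification · IR pin · box ·
both window memberships · selector) hold at the record bundle from `D.Tuned γ gIR g₀` and `γ ≤ θ.γ` ALONE; only (T)'s upper running keeps a β-side letter, read here from K1⁷'s
interval-form window `DagBinding.BetaBoundsInInterval D.C.toB12 γ₀ b b′` (the binder of the K1⁷ skeleton's rung 2 ∕ N24's knit) as `β′_T := max b′ 0`.

* §1 `invSq_le_of_rgEqH_along` — upper running from a bound ALONG THE HISTORY (no box, no sign) · ★ `runLetters_of_rgEqH_tuned` (generic datum: the companion's knit with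
  the run identification `hrg` and the along-history bound `halong` as INPUTS).
* §2 ★ `rgEqH_runFlow_datumOfRecord₁₃CoPH_of_inInterval` ∕ `_of_tuned` — (0.20) for the runs of record at the ₁₃ `CoPH` datum from the interval ALONE ·
  `betaAlong_runFlow_le_of_betaBoundsInInterval` (K1⁷'s interval bound ⇒ `β ≤ b′` along the runs of record) ·
  ★★ `runLetters_rateCarriersOfRecord₁₃CoPH_of_tuned_interval` (ALL seven run clauses + `0 < gIR ≤ γ` + agreement at `R := rateCarriersOfRecord₁₃CoPH 𝔯 F θ hP g₀ os k`, from
  tuning + the interval-form window) · ★★ `runLettersCore_rateCarriersOfRecord₁₃CoPH_of_tuned` (the six β-free clauses + `0 < gIR ≤ γ` + agreement from `D.Tuned` and `γ ≤ θ.γ` ONLY).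
* §3 `eventualLowerH_rateCarriersOfRecord₁₃CoPH_of_betaLowerH` — (v′-17)'s β-window letter `EventualLowerH bβ R.u3.γ k₀β D.βfun` from the
  K1-side BOX lower bound `BetaLowerH bβ γ₀ D.βfun`, `θ.γ ≤ γ₀` (N24's `hlo` at the ₁₃ record; UNPRINTED lower half, T09.F — a hypothesis), any `k₀β`.

HONEST FRAMING.  Count-neutral kernel bookkeeping over landed theorems BY NAME; `D.Tuned γ gIR g₀` (K2⁷'s ∕ [B12] Thm 2's content at the datum of record) and
`BetaBoundsInInterval` (K1⁷'s β-window binder; lower half UNPRINTED T09.F, upper half printed p. 264 with proof deferred) are HYPOTHESES — nothing of Bałaban's is asserted or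
instantiated; no `Provisos₁₃CoPH` inhabitant claimed (K0⁷ OPEN); NE7 NOT PRINTED for d = 4 and NOT PROVED; N19 NOT discharged; K3⁷ NOT claimed; counts UNMOVED (typed 28∕28 ·
discharged 5∕27 · A 5∕28).  One finite four-torus programme at fixed `ε` — R4 closes the CONDITIONAL finite-𝕋⁴ rung `BalabanLadder.UV` only; NOT continuum ∕ ℝ⁴ ∕ OS; the YM mass gap
(Clay) is NOT proved by any of this.  No decl below carries a cite tag.
-/

noncomputable section

namespace Summit.QuantumFields.YangMills.BalabanUVNodes.N19RateEdgeRecordRunLettersTuned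

open Literature.MathematicalPhysics.QuantumFieldTheory.Balaban1983to89
open Literature.MathematicalPhysics.QuantumFieldTheory.Balaban1983to89.T4Continuum
open Literature.MathematicalPhysics.QuantumFieldTheory.Balaban1983to89.FlowStep (HBeta RGEqH prefixOf)
open Literature.MathematicalPhysics.QuantumFieldTheory.Balaban1983to89.T4OutputRate (Window)
open Summit.QuantumFields.BalabanUV.T4Continuum.Spine.NE4 (runFlow box_and_pin_of_tuned)
open Summit.QuantumFields.YangMills.BalabanUVNodes.N19RateEdgeRecordRunLetters (rgEqH_congr)
open YMDAG.UVSplit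
open Node00 (Stage13HParams datumOfRecord₁₃CoPH)

variable {F : T4Family} {N : ℕ} [NeZero N]

/-! ## §1 Generic: the upper running along the history; the run letters from (0.20) + tuning -/

/-- The upper running along one solution of (0.20) from a bound `β ≤ β′_T` ALONG ITS OWN HISTORY (not on the whole box): `1∕g_j² ≤ 1∕g_K² + β′_T·(K − j)`,
`j ≤ K` (telescoped (0.20); no sign of `β′_T` needed). [folklore] -/
theorem invSq_le_of_rgEqH_along {K : ℕ} {β : HBeta} {r : ℕ → ℝ} {β'T : ℝ} (hrg : RGEqH K β r)
    (halong : ∀ i, i < K → β i (prefixOf r i) ≤ β'T) {j : ℕ} (hj : j ≤ K) :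
    1 / r j ^ 2 ≤ 1 / r K ^ 2 + β'T * ((K : ℝ) - j) := by
  have ht := FlowStep.inv_sq_telescopeH hrg hj le_rfl
  have hsum : ∑ i ∈ Finset.Ico j K, β i (prefixOf r i) ≤ ∑ _i ∈ Finset.Ico j K, β'T :=
    Finset.sum_le_sum fun i hi => halong i (Finset.mem_Ico.mp hi).2
  rw [Finset.sum_const, Nat.card_Ico, nsmul_eq_mul, Nat.cast_sub hj] at hsum
  rw [ht]
  linarith

/-- **THE RUN LETTERS FROM (0.20) ALONG THE RUNS OF RECORD + TUNING** [bookkeeping] — the β-bound-free core of `runLetters_of_tuned`: GIVEN the history recursion for every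
cutoff-`K` run of record (`hrg`) and a bound `β ≤ β′_T` along those histories (`halong`; take `β′_T` from the printed box bound or from K1⁷'s interval bound, §2's
corollaries), a bare sequence tuned to `gIR` within `]0, γ]` gives, at any window radius `γ′ ≥ γ`, the window-extended runs with ALL the (v′-17) run clauses, (T)'s upper running
with the letter `β′_T`, `0 < gIR ≤ γ`, and agreement with `runFlow` up to the cutoff. -/
theorem runLetters_of_rgEqH_tuned (D : Datum F N) {γ gIR γ' β'T : ℝ} {g₀ : ℕ → ℝ}
    (hrg : ∀ K, RGEqH K D.βfun (runFlow D g₀ K)) (halong : ∀ K i, i < K → D.βfun i (prefixOf (runFlow D g₀ K) i) ≤ β'T)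
    (ht : D.Tuned γ gIR g₀) (hγle : γ ≤ γ') :
    ∃ (g : ℕ → ℕ → ℝ) (bsel : (ℕ → ℝ) → ℝ),
      (∀ K, RGEqH K D.βfun (g K)) ∧ (∀ K, g K K = gIR) ∧
      (∀ K i, i ≤ K → 0 < g K i ∧ g K i ≤ γ') ∧
      (∀ K, g K ∈ Window γ') ∧ (∀ K, (fun i => g (K + 1) (i + 1)) ∈ Window γ') ∧
      (∀ s ∈ Window γ', 0 < bsel s ∧ bsel s ≤ γ') ∧
      (∀ K j, j ≤ K → 1 / g K j ^ 2 ≤ 1 / gIR ^ 2 + β'T * ((K : ℝ) - j)) ∧ 0 < gIR ∧ gIR ≤ γ ∧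
      (∀ K i, i ≤ K → g K i = runFlow D g₀ K i) := by
  obtain ⟨hbox, hpin⟩ := box_and_pin_of_tuned D ht
  have hIR : 0 < gIR ∧ gIR ≤ γ := by
    have h := hbox 0 0 le_rfl
    rwa [hpin 0] at h
  refine ⟨fun K i => if i ≤ K then runFlow D g₀ K i else gIR, fun _ => gIR, ?_, ?_, ?_, ?_, ?_, ?_, ?_, hIR.1, hIR.2, ?_⟩
  · intro K
    exact rgEqH_congr (hrg K) fun i hi => by simp only [if_pos hi]
  · intro K
    simp only [if_pos le_rfl]
    exact hpin K
  · intro K i hi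
    simp only [if_pos hi]
    exact ⟨(hbox K i hi).1, (hbox K i hi).2.trans hγle⟩
  · intro K i
    by_cases hi : i ≤ K
    · simp only [if_pos hi]
      exact ⟨(hbox K i hi).1, (hbox K i hi).2.trans hγle⟩
    · simp only [if_neg hi]
      exact ⟨hIR.1, hIR.2.trans hγle⟩
  · intro K i
    by_cases hi : i + 1 ≤ K + 1
    · simp only [if_pos hi]
      exact ⟨(hbox (K + 1) (i + 1) hi).1, (hbox (K + 1) (i + 1) hi).2.trans hγle⟩
    · simp only [if_neg hi]
      exact ⟨hIR.1, hIR.2.trans hγle⟩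
  · intro s _
    exact ⟨hIR.1, hIR.2.trans hγle⟩
  · intro K j hj
    have h := invSq_le_of_rgEqH_along (hrg K) (halong K) hj
    rw [hpin K] at h
    simpa only [if_pos hj] using h
  · intro K i hi
    simp only [if_pos hi]

/-! ## §2 At the ₁₃ `CoPH` record: (0.20) from the interval alone, the along-history bound from K1⁷'s window, the run letters -/

/-- **(0.20) FOR THE RUNS OF RECORD AT THE ₁₃ `CoPH` DATUM, FROM THE INTERVAL ALONE** [bookkeeping]: a cutoff-`K` run of `datumOfRecord₁₃CoPH F N θ hP` that stays in some `]0, γ]`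
solves the history recursion with the datum's `βfun` — NO β-bound hypothesis: the datum is forward-generated (`D.fwd`), curries its β (`D.curries`) and HALTS OUTSIDE
(dag-n26-c's `haltsOutside_datumOfRecord₁₃CoPH`, def-T's `RGMachineCore.haltsOutside` underneath; `βfun_datumOfRecord₁₃CoPH` is `rfl`) — `FlowStepRuns.rgEqH_of_inInterval` BY NAME. -/
theorem rgEqH_runFlow_datumOfRecord₁₃CoPH_of_inInterval (θ : Stage13HParams F N) (hP : θ.Provisos₁₃CoPH F N) {γ : ℝ} {g₀ : ℕ → ℝ} {K : ℕ}
    (hI : ((datumOfRecord₁₃CoPH F N θ hP).C ⟨K, F.m, g₀ K⟩).flow.InInterval γ K) :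
    RGEqH K (datumOfRecord₁₃CoPH F N θ hP).βfun (runFlow (datumOfRecord₁₃CoPH F N θ hP) g₀ K) :=
  FlowStepRuns.rgEqH_of_inInterval (datumOfRecord₁₃CoPH F N θ hP).fwd
    (Summit.QuantumFields.YangMills.Theorems.BalabanUVNodesN26AtRecord13CoPH.haltsOutside_datumOfRecord₁₃CoPH F N θ hP)
    (datumOfRecord₁₃CoPH F N θ hP).curries ⟨K, F.m, g₀ K⟩ hI

/-- … hence for EVERY cutoff along a TUNED bare sequence. [bookkeeping] -/
theorem rgEqH_runFlow_datumOfRecord₁₃CoPH_of_tuned (θ : Stage13HParams F N) (hP : θ.Provisos₁₃CoPH F N) {γ gIR : ℝ} {g₀ : ℕ → ℝ}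
    (ht : (datumOfRecord₁₃CoPH F N θ hP).Tuned γ gIR g₀) (K : ℕ) :
    RGEqH K (datumOfRecord₁₃CoPH F N θ hP).βfun (runFlow (datumOfRecord₁₃CoPH F N θ hP) g₀ K) :=
  rgEqH_runFlow_datumOfRecord₁₃CoPH_of_inInterval θ hP (ht K).1

/-- **β ALONG THE HISTORIES OF RECORD FROM K1⁷'s INTERVAL-FORM BOUND** [bookkeeping]: `BetaBoundsInInterval D.C.toB12 γ₀ b b′` (the β-window binder of the K1⁷ skeleton's
rung 2 ∕ N24's knit, [Balaban1987RG1] (1.22) p. 264 upper half) gives, along every cutoff-`K` run in `]0, γ]`, `γ ≤ γ₀`, the bound `D.βfun i (g_0,…,g_i) ≤ b′` for `i < K`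
(`D.curries` + `DagBinding.update_prefixOf_last`). -/
theorem betaAlong_runFlow_le_of_betaBoundsInInterval (D : Datum F N) {γ₀ b b' γ : ℝ} (hβ : DagBinding.BetaBoundsInInterval D.C.toB12 γ₀ b b') (hγle : γ ≤ γ₀)
    {g₀ : ℕ → ℝ} {K : ℕ} (hI : (D.C ⟨K, F.m, g₀ K⟩).flow.InInterval γ K) :
    ∀ i, i < K → D.βfun i (prefixOf (runFlow D g₀ K) i) ≤ b' := by
  intro i hi
  have hc := D.curries ⟨K, F.m, g₀ K⟩ i ((D.C.toB12 ⟨K, F.m, g₀ K⟩).flow.g i) hi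
  rw [DagBinding.update_prefixOf_last] at hc
  have h := (hβ ⟨K, F.m, g₀ K⟩ i ((D.C.toB12 ⟨K, F.m, g₀ K⟩).flow.g i) hi
    (fun l hl => ⟨(hI l (by omega)).1, (hI l (by omega)).2.trans hγle⟩) (hI i hi.le).1 ((hI i hi.le).2.trans hγle)).2
  rw [hc] at h
  exact h

/-- **★ THE (v′-17) RUN LETTERS AT THE ₁₃ RECORD BUNDLE FROM TUNING ALONE** [bookkeeping]: NO β-bound hypothesis for the run identification (§2's (0.20) guard of record); the upper
running is read with the letter `β′_T := max b′ 0` from K1⁷'s interval-form window `BetaBoundsInInterval D.C.toB12 γ₀ b b′` (`γ ≤ γ₀`).  Every clause with `R.u3.W`, `R.u3.γ`,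
`D.βfun` LITERAL at `R := rateCarriersOfRecord₁₃CoPH 𝔯 F θ hP g₀ os k`, `D := datumOfRecord₁₃CoPH F N θ hP`, every `os`, `k`. -/
theorem runLetters_rateCarriersOfRecord₁₃CoPH_of_tuned_interval (𝔯 : RateReading₁₃CoPH N) (θ : Stage13HParams F N) (hP : θ.Provisos₁₃CoPH F N)
    {γ₀ b b' γ gIR : ℝ} {g₀ : ℕ → ℝ} (hβ : DagBinding.BetaBoundsInInterval (datumOfRecord₁₃CoPH F N θ hP).C.toB12 γ₀ b b') (hγ₀ : γ ≤ γ₀)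
    (ht : (datumOfRecord₁₃CoPH F N θ hP).Tuned γ gIR g₀) (hγle : γ ≤ θ.γ) (os : List (ULoop F)) (k : ℕ) :
    ∃ (g : ℕ → ℕ → ℝ) (bsel : (ℕ → ℝ) → ℝ),
      (∀ K, RGEqH K (datumOfRecord₁₃CoPH F N θ hP).βfun (g K)) ∧ (∀ K, g K K = gIR) ∧
      (∀ K i, i ≤ K → 0 < g K i ∧ g K i ≤ (rateCarriersOfRecord₁₃CoPH 𝔯 F θ hP g₀ os k).u3.γ) ∧
      (∀ K, g K ∈ (rateCarriersOfRecord₁₃CoPH 𝔯 F θ hP g₀ os k).u3.W) ∧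
      (∀ K, (fun i => g (K + 1) (i + 1)) ∈ (rateCarriersOfRecord₁₃CoPH 𝔯 F θ hP g₀ os k).u3.W) ∧
      (∀ s ∈ (rateCarriersOfRecord₁₃CoPH 𝔯 F θ hP g₀ os k).u3.W,
        0 < bsel s ∧ bsel s ≤ (rateCarriersOfRecord₁₃CoPH 𝔯 F θ hP g₀ os k).u3.γ) ∧
      (∀ K j, j ≤ K → 1 / g K j ^ 2 ≤ 1 / gIR ^ 2 + max b' 0 * ((K : ℝ) - j)) ∧
      0 < gIR ∧ gIR ≤ γ ∧ (∀ K i, i ≤ K → g K i = runFlow (datumOfRecord₁₃CoPH F N θ hP) g₀ K i) :=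
  runLetters_of_rgEqH_tuned (datumOfRecord₁₃CoPH F N θ hP) (rgEqH_runFlow_datumOfRecord₁₃CoPH_of_tuned θ hP ht)
    (fun K i hi => (betaAlong_runFlow_le_of_betaBoundsInInterval _ hβ hγ₀ (ht K).1 i hi).trans (le_max_left _ _)) ht hγle

/-- **★ … AND WITH NO β-SIDE HYPOTHESIS AT ALL, WITHOUT THE UPPER-RUNNING CLAUSE** [bookkeeping]: run identification · IR pin · box · both window memberships · selector · `0 < gIR ≤ γ` ·
agreement, at the ₁₃ record bundle, from `D.Tuned γ gIR g₀` and `γ ≤ θ.γ` ONLY. -/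
theorem runLettersCore_rateCarriersOfRecord₁₃CoPH_of_tuned (𝔯 : RateReading₁₃CoPH N) (θ : Stage13HParams F N) (hP : θ.Provisos₁₃CoPH F N)
    {γ gIR : ℝ} {g₀ : ℕ → ℝ} (ht : (datumOfRecord₁₃CoPH F N θ hP).Tuned γ gIR g₀) (hγle : γ ≤ θ.γ) (os : List (ULoop F)) (k : ℕ) :
    ∃ (g : ℕ → ℕ → ℝ) (bsel : (ℕ → ℝ) → ℝ),
      (∀ K, RGEqH K (datumOfRecord₁₃CoPH F N θ hP).βfun (g K)) ∧ (∀ K, g K K = gIR) ∧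
      (∀ K i, i ≤ K → 0 < g K i ∧ g K i ≤ (rateCarriersOfRecord₁₃CoPH 𝔯 F θ hP g₀ os k).u3.γ) ∧
      (∀ K, g K ∈ (rateCarriersOfRecord₁₃CoPH 𝔯 F θ hP g₀ os k).u3.W) ∧
      (∀ K, (fun i => g (K + 1) (i + 1)) ∈ (rateCarriersOfRecord₁₃CoPH 𝔯 F θ hP g₀ os k).u3.W) ∧
      (∀ s ∈ (rateCarriersOfRecord₁₃CoPH 𝔯 F θ hP g₀ os k).u3.W,
        0 < bsel s ∧ bsel s ≤ (rateCarriersOfRecord₁₃CoPH 𝔯 F θ hP g₀ os k).u3.γ) ∧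
      0 < gIR ∧ gIR ≤ γ ∧ (∀ K i, i ≤ K → g K i = runFlow (datumOfRecord₁₃CoPH F N θ hP) g₀ K i) := by
  -- no `K`-uniform along-history bound is available without a β-side letter, so the upper-running clause is dropped and the seven clauses re-derived directly
  obtain ⟨hbox, hpin⟩ := box_and_pin_of_tuned (datumOfRecord₁₃CoPH F N θ hP) ht
  have hIR : 0 < gIR ∧ gIR ≤ γ := by
    have h := hbox 0 0 le_rfl
    rwa [hpin 0] at h
  refine ⟨fun K i => if i ≤ K then runFlow (datumOfRecord₁₃CoPH F N θ hP) g₀ K i else gIR, fun _ => gIR, ?_, ?_, ?_, ?_, ?_, ?_,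
    hIR.1, hIR.2, ?_⟩
  · intro K
    exact rgEqH_congr (rgEqH_runFlow_datumOfRecord₁₃CoPH_of_tuned θ hP ht K) fun i hi => by simp only [if_pos hi]
  · intro K
    simp only [if_pos le_rfl]
    exact hpin K
  · intro K i hi
    simp only [if_pos hi]
    exact ⟨(hbox K i hi).1, (hbox K i hi).2.trans hγle⟩
  · intro K i
    by_cases hi : i ≤ K
    · simp only [if_pos hi]
      exact ⟨(hbox K i hi).1, (hbox K i hi).2.trans hγle⟩
    · simp only [if_neg hi]
      exact ⟨hIR.1, hIR.2.trans hγle⟩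
  · intro K i
    by_cases hi : i + 1 ≤ K + 1
    · simp only [if_pos hi]
      exact ⟨(hbox (K + 1) (i + 1) hi).1, (hbox (K + 1) (i + 1) hi).2.trans hγle⟩
    · simp only [if_neg hi]
      exact ⟨hIR.1, hIR.2.trans hγle⟩
  · intro s _
    exact ⟨hIR.1, hIR.2.trans hγle⟩
  · intro K i hi
    simp only [if_pos hi]

/-! ## §3 (v′-17)'s β-window letter `EventualLowerH` at the record from the K1-side BOX lower bound -/

/-- **(v′-17)'s `EventualLowerH bβ R.u3.γ k₀β D.βfun` AT THE ₁₃ RECORD BUNDLE** [bookkeeping] from the K1-side box binder `BetaLowerH bβ γ₀ D.βfun` on a box `]0, γ₀] ⊇ ]0, θ.γ]`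
(N24's `hlo` at the `CoPH` record; lower half UNPRINTED, T09.F — a HYPOTHESIS), for any threshold `k₀β`; `R.u3.γ = θ.γ` by `rfl`; the tree's
`T4CouplingMatching.eventualLowerH_of_betaLowerH` BY NAME after `FlowStep.box_mono`. -/
theorem eventualLowerH_rateCarriersOfRecord₁₃CoPH_of_betaLowerH (𝔯 : RateReading₁₃CoPH N) (θ : Stage13HParams F N) (hP : θ.Provisos₁₃CoPH F N)
    (g₀ : ℕ → ℝ) (os : List (ULoop F)) (k : ℕ) {bβ γ₀ : ℝ} (h : FlowStep.BetaLowerH bβ γ₀ (datumOfRecord₁₃CoPH F N θ hP).βfun) (hle : θ.γ ≤ γ₀) (k₀β : ℕ) :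
    T4CouplingMatching.EventualLowerH bβ (rateCarriersOfRecord₁₃CoPH 𝔯 F θ hP g₀ os k).u3.γ k₀β (datumOfRecord₁₃CoPH F N θ hP).βfun :=
  T4CouplingMatching.eventualLowerH_of_betaLowerH (fun j v hv => h j v (FlowStep.box_mono hle j hv)) k₀β

end Summit.QuantumFields.YangMills.BalabanUVNodes.N19RateEdgeRecordRunLettersTuned

end
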